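import Literature.Analysis.FluidPDE.PassiveVectorModeEnergy
import Literature.Analysis.FunctionSpaces.TorusLerayFrame
import HarnessLib

/-!
# Weak passive-vector solutions: the energy identity of one Fourier mode (vector form) and the
# modewise dissipation bound

Analysis/FluidPDE proof-support file (everything proved; no new definitions). Second brick of the
vector Fourier–Galerkin energy argument for `Torus.IsWeakPassiveVectorOn A T ν b w₀ w`
(`∂ₜw + (b·∇)w + A (w·∇)b + ∇π = νΔw`, `∇·w = 0`; Yoshida–Kaneda 2000, (4)–(5)). With
`ŵ(t)(k) = 𝓕(complexify ∘ w(t))(k)`, `F_j = 𝓕(bⱼ w)`, `G_j = 𝓕(wⱼ b)` and the linear form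
`B_τ(z) = ∑ⱼ 2πikⱼ ⟪F_j(τ)(k), z⟫ + A ∑ⱼ 2πikⱼ ⟪G_j(τ)(k), z⟫`:

* `IsWeakPassiveVectorOn.ae_sq_norm_mFourierCoeff_eq` — **the energy identity of one mode**: for a
  datum `w₀ ∈ L²` weakly divergence free, every `k` and a.e. `t ∈ (0,T)`,
  `‖ŵ(t)(k)‖² = ‖ŵ₀(k)‖² + 2 ∫_{(0,t]} (-4π²ν|k|² ‖ŵ(τ)(k)‖² + Re B_τ(ŵ(τ)(k))) dτ`.
  Proof: sum the tested identities `PassiveVectorModeEnergy.ae_sq_norm_inner_mFourierCoeff_eq` over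
  the Leray frame `z⁽ⁱ⁾(k) = |k|² eᵢ - kᵢ k` (`TorusLerayFrame`): `∑ᵢ |⟪X, z⁽ⁱ⁾⟫|² = |k|⁴‖X‖²` and
  `∑ᵢ conj⟪X, z⁽ⁱ⁾⟫ B(z⁽ⁱ⁾) = |k|⁴ B(X)` for the transversal vectors `X = ŵ(τ)(k)` (a.e. `τ`), then
  divide by `|k|⁴`; the mode `k = 0` is constant in time.
* `IsWeakPassiveVectorOn.ae_sq_norm_add_dissipation_le` — **the modewise dissipation bound** for
  `ν > 0` and a carrier bounded by `M`:
  `‖ŵ(t)(k)‖² + 4π²ν|k|² ∫_{(0,t]} ‖ŵ(τ)(k)‖² dτ ≤ ‖ŵ₀(k)‖² + ((1+A²)/ν) ∫_{(0,t]} γ_k`,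
  `γ_k = ∑ⱼ (‖F_j(k)‖² + ‖G_j(k)‖²)` (Young: `2|B_τ(X)| ≤ 4π²ν|k|²‖X‖² + (1+A²)γ_k/ν`) — the uniform
  Galerkin bound behind the `L²_t H¹_x` regularity of weak solutions with bounded carrier
  (Robinson–Rodrigo–Sadowski 2016, (4.20); summed over `k` with Plancherel it bounds
  `ν ∫₀ᵗ ‖∇w‖²` by `‖w₀‖² + 2d(1+A²)M²ν⁻¹ ∫₀ᵗ ‖w‖²`).

## Mathlib / tree search

Tree: `PassiveVectorModeEnergy`, `PassiveVectorUniqueness` (`ae_tsum_enorm_sq_mFourierCoeff_products_le`,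
`ae_sum_mul_mFourierCoeff_eq_zero`), `PassiveVectorFourier`, `TorusLerayFrame`
(`sum_norm_sq_inner_lerayFrameVec`, `sum_inner_mul_inner_lerayFrameVec`), `TorusTrigPoly`
(`IsWeaklyDivFree.sum_mul_mFourierCoeff_eq_zero`).

## References

* J. C. Robinson, J. L. Rodrigo, W. Sadowski, *The three-dimensional Navier–Stokes equations*
  (CUP 2016), §4.2 (4.20), Ch. 2 Def. 2.8. [`RobinsonRodrigoSadowski2016`]
* K. Yoshida, Y. Kaneda, Phys. Rev. E 63 (2000) 016308, §II eq. (4)–(5). [`YoshidaKaneda2000`]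
-/

noncomputable section

open MeasureTheory Set Filter Function TopologicalSpace Complex UnitAddTorus
open scoped ENNReal NNReal InnerProductSpace ComplexConjugate

namespace Literature.Analysis.FluidPDE

namespace Torus

variable {d : Type*} [Fintype d]

/-! ## Algebra of the mode right-hand side on the Leray frame -/

section FrameAlgebra

variable [DecidableEq d]

omit [DecidableEq d] in
/-- The mode right-hand side is a pairing: `∑ⱼ 2πikⱼ ⟪Fⱼ, z⟫ + A ∑ⱼ 2πikⱼ ⟪Gⱼ, z⟫ = ⟪β⃗, z⟫` with
`β⃗ = ∑ⱼ conj(2πikⱼ) Fⱼ + ∑ⱼ A conj(2πikⱼ) Gⱼ`. [cite: RobinsonRodrigoSadowski2016, Ch. 2 Def. 2.8] -/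
theorem modeRHS_eq_inner (k : d → ℤ) (A : ℝ) (F G : d → EuclideanSpace ℂ d) (z : EuclideanSpace ℂ d) :
    (∑ j, (2 * Real.pi * I * (k j)) * ⟪F j, z⟫_ℂ) + (A : ℂ) * ∑ j, (2 * Real.pi * I * (k j)) * ⟪G j, z⟫_ℂ =
      ⟪(∑ j, (conj (2 * Real.pi * I * (k j) : ℂ)) • F j) +
        ∑ j, ((A : ℂ) * conj (2 * Real.pi * I * (k j) : ℂ)) • G j, z⟫_ℂ := by
  rw [inner_add_left, sum_inner, sum_inner, Finset.mul_sum]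
  congr 1
  · refine Finset.sum_congr rfl fun j _ => ?_
    rw [inner_smul_left, Complex.conj_conj]
  · refine Finset.sum_congr rfl fun j _ => ?_
    rw [inner_smul_left, map_mul, Complex.conj_conj, Complex.conj_ofReal]
    ring

/-- For a transversal `X` and every `Y`: `∑ᵢ conj⟪X, z⁽ⁱ⁾⟫ ⟪Y, z⁽ⁱ⁾⟫ = |k|⁴ ⟪Y, X⟫` (conjugate of the
Galerkin pairing identity `TorusLerayFrame.sum_inner_mul_inner_lerayFrameVec`). [cite: RobinsonRodrigoSadowski2016, Ch. 2 Def. 2.8] -/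
theorem sum_conj_inner_mul_inner_lerayFrameVec (k : d → ℤ) {X : EuclideanSpace ℂ d}
    (hX : ∑ j, ((k j : ℤ) : ℂ) * X j = 0) (Y : EuclideanSpace ℂ d) :
    ∑ i, conj ⟪X, FunctionSpaces.Torus.lerayFrameVec k i⟫_ℂ * ⟪Y, FunctionSpaces.Torus.lerayFrameVec k i⟫_ℂ =
      ((FunctionSpaces.Torus.freqNormSq k : ℝ) : ℂ) ^ 2 * ⟪Y, X⟫_ℂ := by
  have h := FunctionSpaces.Torus.sum_inner_mul_inner_lerayFrameVec k hX Y
  calc ∑ i, conj ⟪X, FunctionSpaces.Torus.lerayFrameVec k i⟫_ℂ * ⟪Y, FunctionSpaces.Torus.lerayFrameVec k i⟫_ℂ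
      = conj (∑ i, ⟪X, FunctionSpaces.Torus.lerayFrameVec k i⟫_ℂ * ⟪FunctionSpaces.Torus.lerayFrameVec k i, Y⟫_ℂ) := by
        rw [map_sum]
        refine Finset.sum_congr rfl fun i _ => ?_
        rw [map_mul, inner_conj_symm Y (FunctionSpaces.Torus.lerayFrameVec k i)]
    _ = ((FunctionSpaces.Torus.freqNormSq k : ℝ) : ℂ) ^ 2 * ⟪Y, X⟫_ℂ := by
        rw [h, map_mul, map_pow, Complex.conj_ofReal, inner_conj_symm Y X]

/-- **The mode right-hand side summed over the Leray frame**: for a transversal `X`,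
`∑ᵢ conj⟪X, z⁽ⁱ⁾⟫ B(z⁽ⁱ⁾) = |k|⁴ B(X)`. [cite: RobinsonRodrigoSadowski2016, Ch. 2 Def. 2.8] -/
theorem sum_conj_inner_mul_modeRHS (k : d → ℤ) {X : EuclideanSpace ℂ d}
    (hX : ∑ j, ((k j : ℤ) : ℂ) * X j = 0) (A : ℝ) (F G : d → EuclideanSpace ℂ d) :
    ∑ i, conj ⟪X, FunctionSpaces.Torus.lerayFrameVec k i⟫_ℂ *
        ((∑ j, (2 * Real.pi * I * (k j)) * ⟪F j, FunctionSpaces.Torus.lerayFrameVec k i⟫_ℂ) +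
          (A : ℂ) * ∑ j, (2 * Real.pi * I * (k j)) * ⟪G j, FunctionSpaces.Torus.lerayFrameVec k i⟫_ℂ) =
      ((FunctionSpaces.Torus.freqNormSq k : ℝ) : ℂ) ^ 2 *
        ((∑ j, (2 * Real.pi * I * (k j)) * ⟪F j, X⟫_ℂ) + (A : ℂ) * ∑ j, (2 * Real.pi * I * (k j)) * ⟪G j, X⟫_ℂ) := by
  simp_rw [modeRHS_eq_inner k A F G]
  exact sum_conj_inner_mul_inner_lerayFrameVec k hX _

/-- `(a + |A| b)² ≤ (1 + A²)(a² + b²)`. [folklore] -/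
private theorem sq_add_abs_mul_le' (A a b : ℝ) : (a + |A| * b) ^ 2 ≤ (1 + A ^ 2) * (a ^ 2 + b ^ 2) := by
  nlinarith [sq_nonneg (|A| * a - b), sq_abs A]

omit [DecidableEq d] in
/-- `|B(z)| ≤ 2π√|k|² ‖z‖ √((1+A²) γ)` in squared form:
`‖B(z)‖² ≤ 4π²|k|² (1 + A²) ‖z‖² ∑ⱼ (‖Fⱼ‖² + ‖Gⱼ‖²)` (Cauchy–Schwarz). [folklore] -/
private theorem norm_sq_modeRHS_le' (A : ℝ) (k : d → ℤ) (z : EuclideanSpace ℂ d) (F G : d → EuclideanSpace ℂ d) :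
    ‖(∑ j, (2 * Real.pi * I * (k j)) * ⟪F j, z⟫_ℂ) + (A : ℂ) * ∑ j, (2 * Real.pi * I * (k j)) * ⟪G j, z⟫_ℂ‖ ^ 2 ≤
      4 * Real.pi ^ 2 * FunctionSpaces.Torus.freqNormSq k * ((1 + A ^ 2) * ‖z‖ ^ 2) *
        ∑ j, (‖F j‖ ^ 2 + ‖G j‖ ^ 2) := by
  have hkj : ∀ j, ‖(2 * Real.pi * I * (k j) : ℂ)‖ = 2 * Real.pi * |(k j : ℝ)| := by
    intro j
    rw [norm_mul, norm_mul, norm_mul, Complex.norm_I, mul_one, Complex.norm_intCast, Complex.norm_real,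
      Real.norm_eq_abs, abs_of_pos Real.pi_pos, ← Int.cast_abs, Int.cast_abs]
    norm_num
  have h1 : ‖(∑ j, (2 * Real.pi * I * (k j)) * ⟪F j, z⟫_ℂ) + (A : ℂ) * ∑ j, (2 * Real.pi * I * (k j)) * ⟪G j, z⟫_ℂ‖ ≤
      ∑ j, (2 * Real.pi * |(k j : ℝ)|) * (‖z‖ * (‖F j‖ + |A| * ‖G j‖)) := by
    rw [Finset.mul_sum, ← Finset.sum_add_distrib]
    refine (norm_sum_le _ _).trans (Finset.sum_le_sum fun j _ => ?_)
    have a1 : ‖(2 * Real.pi * I * (k j)) * ⟪F j, z⟫_ℂ‖ ≤ 2 * Real.pi * |(k j : ℝ)| * (‖F j‖ * ‖z‖) := by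
      rw [norm_mul, hkj]
      exact mul_le_mul_of_nonneg_left (norm_inner_le_norm _ _) (by positivity)
    have a2 : ‖(A : ℂ) * ((2 * Real.pi * I * (k j)) * ⟪G j, z⟫_ℂ)‖ ≤
        |A| * (2 * Real.pi * |(k j : ℝ)| * (‖G j‖ * ‖z‖)) := by
      rw [norm_mul, norm_mul, hkj, Complex.norm_real, Real.norm_eq_abs]
      exact mul_le_mul_of_nonneg_left (mul_le_mul_of_nonneg_left (norm_inner_le_norm _ _) (by positivity))
        (abs_nonneg _)
    calc ‖(2 * Real.pi * I * (k j)) * ⟪F j, z⟫_ℂ + (A : ℂ) * ((2 * Real.pi * I * (k j)) * ⟪G j, z⟫_ℂ)‖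
        ≤ ‖(2 * Real.pi * I * (k j)) * ⟪F j, z⟫_ℂ‖ + ‖(A : ℂ) * ((2 * Real.pi * I * (k j)) * ⟪G j, z⟫_ℂ)‖ :=
          norm_add_le _ _
      _ ≤ 2 * Real.pi * |(k j : ℝ)| * (‖F j‖ * ‖z‖) + |A| * (2 * Real.pi * |(k j : ℝ)| * (‖G j‖ * ‖z‖)) :=
          add_le_add a1 a2
      _ = 2 * Real.pi * |(k j : ℝ)| * (‖z‖ * (‖F j‖ + |A| * ‖G j‖)) := by ring
  have h2 : (∑ j, (2 * Real.pi * |(k j : ℝ)|) * (‖z‖ * (‖F j‖ + |A| * ‖G j‖))) ^ 2 ≤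
      (∑ j, (2 * Real.pi * |(k j : ℝ)|) ^ 2) * ∑ j, (‖z‖ * (‖F j‖ + |A| * ‖G j‖)) ^ 2 :=
    Finset.sum_mul_sq_le_sq_mul_sq _ _ _
  have h3 : ∑ j, (2 * Real.pi * |(k j : ℝ)|) ^ 2 = 4 * Real.pi ^ 2 * FunctionSpaces.Torus.freqNormSq k := by
    rw [FunctionSpaces.Torus.freqNormSq, Finset.mul_sum]
    exact Finset.sum_congr rfl fun j _ => by rw [mul_pow, sq_abs]; ring
  have h4 : ∑ j, (‖z‖ * (‖F j‖ + |A| * ‖G j‖)) ^ 2 ≤ (1 + A ^ 2) * ‖z‖ ^ 2 * ∑ j, (‖F j‖ ^ 2 + ‖G j‖ ^ 2) := by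
    rw [Finset.mul_sum]
    refine Finset.sum_le_sum fun j _ => ?_
    rw [mul_pow]
    calc ‖z‖ ^ 2 * (‖F j‖ + |A| * ‖G j‖) ^ 2 ≤ ‖z‖ ^ 2 * ((1 + A ^ 2) * (‖F j‖ ^ 2 + ‖G j‖ ^ 2)) :=
          mul_le_mul_of_nonneg_left (sq_add_abs_mul_le' A _ _) (sq_nonneg _)
      _ = (1 + A ^ 2) * ‖z‖ ^ 2 * (‖F j‖ ^ 2 + ‖G j‖ ^ 2) := by ring
  have hN0 := FunctionSpaces.Torus.freqNormSq_nonneg k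
  calc ‖(∑ j, (2 * Real.pi * I * (k j)) * ⟪F j, z⟫_ℂ) + (A : ℂ) * ∑ j, (2 * Real.pi * I * (k j)) * ⟪G j, z⟫_ℂ‖ ^ 2
      ≤ (∑ j, (2 * Real.pi * |(k j : ℝ)|) * (‖z‖ * (‖F j‖ + |A| * ‖G j‖))) ^ 2 :=
        pow_le_pow_left₀ (norm_nonneg _) h1 2
    _ ≤ (∑ j, (2 * Real.pi * |(k j : ℝ)|) ^ 2) * ∑ j, (‖z‖ * (‖F j‖ + |A| * ‖G j‖)) ^ 2 := h2
    _ ≤ (4 * Real.pi ^ 2 * FunctionSpaces.Torus.freqNormSq k) *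
          ((1 + A ^ 2) * ‖z‖ ^ 2 * ∑ j, (‖F j‖ ^ 2 + ‖G j‖ ^ 2)) := by
        rw [h3]
        exact mul_le_mul_of_nonneg_left h4 (by positivity)
    _ = 4 * Real.pi ^ 2 * FunctionSpaces.Torus.freqNormSq k * ((1 + A ^ 2) * ‖z‖ ^ 2) *
          ∑ j, (‖F j‖ ^ 2 + ‖G j‖ ^ 2) := by ring

omit [DecidableEq d] in
/-- Young's inequality for the mode right-hand side tested against the mode itself (`ν > 0`):
`2 Re B(X) ≤ 4π²ν|k|² ‖X‖² + ((1 + A²)/ν) ∑ⱼ (‖Fⱼ‖² + ‖Gⱼ‖²)`. [folklore] -/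
private theorem two_mul_re_modeRHS_le {ν : ℝ} (hν : 0 < ν) (A : ℝ) (k : d → ℤ) (X : EuclideanSpace ℂ d)
    (F G : d → EuclideanSpace ℂ d) :
    2 * ((∑ j, (2 * Real.pi * I * (k j)) * ⟪F j, X⟫_ℂ) + (A : ℂ) * ∑ j, (2 * Real.pi * I * (k j)) * ⟪G j, X⟫_ℂ).re ≤
      4 * Real.pi ^ 2 * ν * FunctionSpaces.Torus.freqNormSq k * ‖X‖ ^ 2 +
        ((1 + A ^ 2) / ν) * ∑ j, (‖F j‖ ^ 2 + ‖G j‖ ^ 2) := by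
  set B : ℂ := (∑ j, (2 * Real.pi * I * (k j)) * ⟪F j, X⟫_ℂ) + (A : ℂ) * ∑ j, (2 * Real.pi * I * (k j)) * ⟪G j, X⟫_ℂ
    with hB
  set a : ℝ := 4 * Real.pi ^ 2 * ν * FunctionSpaces.Torus.freqNormSq k * ‖X‖ ^ 2 with ha
  set c : ℝ := ((1 + A ^ 2) / ν) * ∑ j, (‖F j‖ ^ 2 + ‖G j‖ ^ 2) with hc
  have hN0 := FunctionSpaces.Torus.freqNormSq_nonneg k
  have hγ0 : 0 ≤ ∑ j, (‖F j‖ ^ 2 + ‖G j‖ ^ 2) := Finset.sum_nonneg fun j _ => by positivity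
  have ha0 : 0 ≤ a := by positivity
  have hc0 : 0 ≤ c := by positivity
  -- `‖B‖² ≤ a c`
  have hsq : ‖B‖ ^ 2 ≤ a * c := by
    refine (norm_sq_modeRHS_le' A k X F G).trans (le_of_eq ?_)
    rw [ha, hc]
    field_simp
  -- `2‖B‖ ≤ a + c`
  have h2 : 2 * ‖B‖ ≤ a + c := by
    have h4 : (2 * ‖B‖) ^ 2 ≤ (a + c) ^ 2 := by nlinarith [hsq, sq_nonneg (a - c), norm_nonneg B]
    exact (pow_le_pow_iff_left₀ (by positivity) (by positivity) two_ne_zero).1 h4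
  calc 2 * B.re ≤ 2 * ‖B‖ := by
        have := Complex.re_le_norm B
        linarith
    _ ≤ a + c := h2

end FrameAlgebra

/-! ## The energy identity of one mode, vector form -/

section ModeEnergy

variable [DecidableEq d]

namespace IsWeakPassiveVectorOn

variable {A T ν : ℝ} {b w : ℝ → UnitAddTorus d → EuclideanSpace ℝ d} {w₀ : UnitAddTorus d → EuclideanSpace ℝ d}

/-- Integrability on `(0,T)` of the mode right-hand-side form `τ ↦ B_τ(z)` for a fixed `z`.
[cite: RobinsonRodrigoSadowski2016, §4.2 (Galerkin energy estimate)] -/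
theorem integrableOn_modeRHS_form (h : IsWeakPassiveVectorOn A T ν b w₀ w) (k : d → ℤ) (z : EuclideanSpace ℂ d) :
    IntegrableOn (fun τ =>
      (∑ j, (2 * Real.pi * I * (k j)) *
          ⟪mFourierCoeff (FunctionSpaces.EuclideanSpace.complexify ∘ fun x => b τ x j • w τ x) k, z⟫_ℂ) +
        (A : ℂ) * ∑ j, (2 * Real.pi * I * (k j)) *
          ⟪mFourierCoeff (FunctionSpaces.EuclideanSpace.complexify ∘ fun x => w τ x j • b τ x) k, z⟫_ℂ)
      (Ioo 0 T) volume :=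
  (integrable_finsetSum _ fun j _ => ((h.integrableOn_mFourierCoeff_carrier_smul j k).inner_const z).const_mul _).add
    ((integrable_finsetSum _ fun j _ =>
      ((h.integrableOn_mFourierCoeff_smul_carrier j k).inner_const z).const_mul _).const_mul _)

/-- The squared mode pairings `τ ↦ |⟪ŵ(τ)(k), z⟫|²` are integrable on `(0,T)` (essentially bounded).
[cite: RobinsonRodrigoSadowski2016, §4.2 (Galerkin energy estimate)] -/
theorem integrableOn_norm_sq_inner (h : IsWeakPassiveVectorOn A T ν b w₀ w) (k : d → ℤ) (z : EuclideanSpace ℂ d) :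
    IntegrableOn (fun τ => ‖⟪mFourierCoeff (FunctionSpaces.EuclideanSpace.complexify ∘ w τ) k, z⟫_ℂ‖ ^ 2)
      (Ioo 0 T) volume := by
  obtain ⟨K, hK⟩ := h.exists_ae_norm_inner_mFourierCoeff_le k z
  have hm : AEStronglyMeasurable
      (fun τ => ‖⟪mFourierCoeff (FunctionSpaces.EuclideanSpace.complexify ∘ w τ) k, z⟫_ℂ‖ ^ 2)
      (volume.restrict (Ioo 0 T)) :=
    (((h.integrableOn_mFourierCoeff k).inner_const z).aestronglyMeasurable.norm.pow 2)
  refine IntegrableOn.of_bound measure_Ioo_lt_top hm (K ^ 2) ?_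
  filter_upwards [hK] with τ hτ
  rw [Real.norm_eq_abs, abs_of_nonneg (sq_nonneg _)]
  exact pow_le_pow_left₀ (norm_nonneg _) hτ 2

/-- The flux energies `γ_k(τ) = ∑ⱼ (‖𝓕(bⱼw)(τ)(k)‖² + ‖𝓕(wⱼb)(τ)(k)‖²)` are integrable on `(0,T)` when
the carrier is bounded by `M` (`γ_k ≤ 2dM² sup ‖w‖₂²`). [cite: RobinsonRodrigoSadowski2016, §4.2 (Galerkin energy estimate)] -/
theorem integrableOn_fluxEnergy (h : IsWeakPassiveVectorOn A T ν b w₀ w) {M : ℝ} (hM : 0 ≤ M)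
    (hbM : ∀ᵐ q ∂(((volume : Measure ℝ).restrict (Ioo 0 T)).prod (volume : Measure (UnitAddTorus d))),
      ‖b q.1 q.2‖ ≤ M) (k : d → ℤ) :
    IntegrableOn (fun τ => ∑ j,
      (‖mFourierCoeff (FunctionSpaces.EuclideanSpace.complexify ∘ fun x => b τ x j • w τ x) k‖ ^ 2 +
        ‖mFourierCoeff (FunctionSpaces.EuclideanSpace.complexify ∘ fun x => w τ x j • b τ x) k‖ ^ 2))
      (Ioo 0 T) volume := by
  obtain ⟨C, hC⟩ := h.ae_lintegral_sq_le
  have hFi : ∀ j, IntegrableOn (fun τ =>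
      mFourierCoeff (FunctionSpaces.EuclideanSpace.complexify ∘ fun x => b τ x j • w τ x) k) (Ioo 0 T) volume :=
    fun j => h.integrableOn_mFourierCoeff_carrier_smul j k
  have hGi : ∀ j, IntegrableOn (fun τ =>
      mFourierCoeff (FunctionSpaces.EuclideanSpace.complexify ∘ fun x => w τ x j • b τ x) k) (Ioo 0 T) volume :=
    fun j => h.integrableOn_mFourierCoeff_smul_carrier j k
  have hslice := h.ae_tsum_enorm_sq_mFourierCoeff_products_le hM hbM
  have hm : AEStronglyMeasurable (fun τ => ∑ j,
      (‖mFourierCoeff (FunctionSpaces.EuclideanSpace.complexify ∘ fun x => b τ x j • w τ x) k‖ ^ 2 +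
        ‖mFourierCoeff (FunctionSpaces.EuclideanSpace.complexify ∘ fun x => w τ x j • b τ x) k‖ ^ 2))
      (volume.restrict (Ioo 0 T)) :=
    Finset.aestronglyMeasurable_fun_sum _ fun j _ =>
      ((hFi j).aestronglyMeasurable.norm.pow 2).add ((hGi j).aestronglyMeasurable.norm.pow 2)
  refine IntegrableOn.of_bound measure_Ioo_lt_top hm (∑ _j : d, (M ^ 2 * C + M ^ 2 * C)) ?_
  filter_upwards [hslice, hC] with τ hτ hτC
  rw [Real.norm_eq_abs, abs_of_nonneg (Finset.sum_nonneg fun j _ => by positivity)]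
  refine Finset.sum_le_sum fun j _ => ?_
  have conv : ∀ (X : EuclideanSpace ℂ d), ‖X‖ₑ ^ 2 ≤ ENNReal.ofReal (M ^ 2) * C → ‖X‖ ^ 2 ≤ M ^ 2 * C := by
    intro X hX
    have h2 : ‖X‖ₑ ^ 2 = ENNReal.ofReal (‖X‖ ^ 2) := by
      rw [← ofReal_norm, ENNReal.ofReal_pow (norm_nonneg _)]
    rw [h2, ← ENNReal.ofReal_coe_nnreal, ← ENNReal.ofReal_mul (sq_nonneg _)] at hX
    exact (ENNReal.ofReal_le_ofReal_iff (by positivity)).1 hX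
  exact add_le_add (conv _ (((ENNReal.le_tsum k).trans (hτ.2 j).1).trans (mul_le_mul_right hτC _)))
    (conv _ (((ENNReal.le_tsum k).trans (hτ.2 j).2).trans (mul_le_mul_right hτC _)))

/-- The zero mode of a weak solution is constant: `ŵ(t)(0) = ŵ₀(0)` for a.e. `t` (test with the
constant fields `eᵢ`). [cite: RobinsonRodrigoSadowski2016, §4.2 (Galerkin energy estimate)] -/
theorem ae_mFourierCoeff_zero_eq (h : IsWeakPassiveVectorOn A T ν b w₀ w) (hw₀ : Integrable w₀ volume) :
    ∀ᵐ t ∂(volume.restrict (Ioo 0 T)),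
      mFourierCoeff (FunctionSpaces.EuclideanSpace.complexify ∘ w t) 0 =
        mFourierCoeff (FunctionSpaces.EuclideanSpace.complexify ∘ w₀) 0 := by
  have hz : ∀ i : d, ∑ j, (((0 : d → ℤ) j : ℤ) : ℂ) * (EuclideanSpace.single i (1 : ℂ) : EuclideanSpace ℂ d) j = 0 := by
    intro i
    simp
  have hall := ae_all_iff.2 fun i => h.ae_inner_mFourierCoeff_eq hw₀ 0 (hz i)
  filter_upwards [hall] with t ht
  ext i
  have hi := ht i
  have h0 : ∫ τ in Ioc 0 t,
      ((-(((4 * Real.pi ^ 2 * ν * FunctionSpaces.Torus.freqNormSq (0 : d → ℤ) : ℝ)) : ℂ)) *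
          ⟪mFourierCoeff (FunctionSpaces.EuclideanSpace.complexify ∘ w τ) 0, EuclideanSpace.single i (1 : ℂ)⟫_ℂ +
        ((∑ j, (2 * Real.pi * I * ((0 : d → ℤ) j)) *
            ⟪mFourierCoeff (FunctionSpaces.EuclideanSpace.complexify ∘ fun x => b τ x j • w τ x) 0,
              EuclideanSpace.single i (1 : ℂ)⟫_ℂ) +
          (A : ℂ) * ∑ j, (2 * Real.pi * I * ((0 : d → ℤ) j)) *
            ⟪mFourierCoeff (FunctionSpaces.EuclideanSpace.complexify ∘ fun x => w τ x j • b τ x) 0,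
              EuclideanSpace.single i (1 : ℂ)⟫_ℂ)) = 0 := by
    rw [integral_congr_ae (ae_of_all _ fun τ => ?_), integral_zero]
    simp [FunctionSpaces.Torus.freqNormSq]
  rw [h0, add_zero, EuclideanSpace.inner_single_right, EuclideanSpace.inner_single_right, one_mul, one_mul] at hi
  exact (starRingEnd ℂ).injective hi

/-- **The energy identity of one Fourier mode, vector form.** For a weak solution with datum
`w₀ ∈ L²` weakly divergence free, every frequency `k` and a.e. `t ∈ (0,T)`:
`‖ŵ(t)(k)‖² = ‖ŵ₀(k)‖² + 2 ∫_{(0,t]} (-4π²ν|k|² ‖ŵ(τ)(k)‖² + Re B_τ(ŵ(τ)(k))) dτ`,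
`B_τ(z) = ∑ⱼ 2πikⱼ ⟪𝓕(bⱼw)(τ)(k), z⟫ + A ∑ⱼ 2πikⱼ ⟪𝓕(wⱼb)(τ)(k), z⟫` (the Leray-projected mode equation
tested against the mode itself; obtained by summing the tested identities over the Leray frame
`z⁽ⁱ⁾(k) = |k|² eᵢ - kᵢ k` and dividing by `|k|⁴`; Robinson–Rodrigo–Sadowski 2016, §4.2).
[cite: RobinsonRodrigoSadowski2016, §4.2 (Galerkin energy estimate)] -/
theorem ae_sq_norm_mFourierCoeff_eq (h : IsWeakPassiveVectorOn A T ν b w₀ w) (hw₀ : MemLp w₀ 2 volume)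
    (hdiv₀ : FunctionSpaces.Torus.IsWeaklyDivFree w₀) (k : d → ℤ) :
    ∀ᵐ t ∂(volume.restrict (Ioo 0 T)),
      ‖mFourierCoeff (FunctionSpaces.EuclideanSpace.complexify ∘ w t) k‖ ^ 2 =
        ‖mFourierCoeff (FunctionSpaces.EuclideanSpace.complexify ∘ w₀) k‖ ^ 2 +
        2 * ∫ τ in Ioc 0 t,
          (-(4 * Real.pi ^ 2 * ν * FunctionSpaces.Torus.freqNormSq k) *
              ‖mFourierCoeff (FunctionSpaces.EuclideanSpace.complexify ∘ w τ) k‖ ^ 2 +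
            ((∑ j, (2 * Real.pi * I * (k j)) *
                ⟪mFourierCoeff (FunctionSpaces.EuclideanSpace.complexify ∘ fun x => b τ x j • w τ x) k,
                  mFourierCoeff (FunctionSpaces.EuclideanSpace.complexify ∘ w τ) k⟫_ℂ) +
              (A : ℂ) * ∑ j, (2 * Real.pi * I * (k j)) *
                ⟪mFourierCoeff (FunctionSpaces.EuclideanSpace.complexify ∘ fun x => w τ x j • b τ x) k,
                  mFourierCoeff (FunctionSpaces.EuclideanSpace.complexify ∘ w τ) k⟫_ℂ).re) := by
  have hw₀i : Integrable w₀ volume := hw₀.integrable one_le_two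
  -- names
  set N : ℝ := FunctionSpaces.Torus.freqNormSq k with hN
  set X : ℝ → EuclideanSpace ℂ d := fun t => mFourierCoeff (FunctionSpaces.EuclideanSpace.complexify ∘ w t) k with hX
  set X₀ : EuclideanSpace ℂ d := mFourierCoeff (FunctionSpaces.EuclideanSpace.complexify ∘ w₀) k with hX₀
  set F : d → ℝ → EuclideanSpace ℂ d := fun j τ =>
    mFourierCoeff (FunctionSpaces.EuclideanSpace.complexify ∘ fun x => b τ x j • w τ x) k with hF
  set G : d → ℝ → EuclideanSpace ℂ d := fun j τ =>
    mFourierCoeff (FunctionSpaces.EuclideanSpace.complexify ∘ fun x => w τ x j • b τ x) k with hG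
  set Z : d → EuclideanSpace ℂ d := fun i => FunctionSpaces.Torus.lerayFrameVec k i with hZ
  by_cases hk : k = 0
  · -- the zero mode is constant and the right-hand side vanishes
    subst hk
    filter_upwards [h.ae_mFourierCoeff_zero_eq hw₀i] with t ht
    have h0 : ∫ τ in Ioc 0 t,
        (-(4 * Real.pi ^ 2 * ν * FunctionSpaces.Torus.freqNormSq (0 : d → ℤ)) * ‖X τ‖ ^ 2 +
          ((∑ j, (2 * Real.pi * I * ((0 : d → ℤ) j)) * ⟪F j τ, X τ⟫_ℂ) +
            (A : ℂ) * ∑ j, (2 * Real.pi * I * ((0 : d → ℤ) j)) * ⟪G j τ, X τ⟫_ℂ).re) = 0 := by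
      rw [integral_congr_ae (ae_of_all _ fun τ => ?_), integral_zero]
      simp [FunctionSpaces.Torus.freqNormSq]
    rw [h0, mul_zero, add_zero]
    exact congrArg (fun v : EuclideanSpace ℂ d => ‖v‖ ^ 2) ht
  -- `k ≠ 0`: sum the tested identities over the Leray frame
  have hNpos : 0 < N := by
    rcases (FunctionSpaces.Torus.freqNormSq_nonneg k).eq_or_lt with h0 | h0
    · exfalso
      apply hk
      funext j
      have hsum0 : ∑ i, ((k i : ℤ) : ℝ) ^ 2 = 0 := by
        rw [FunctionSpaces.Torus.freqNormSq] at h0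
        exact h0.symm
      have hj : ((k j : ℤ) : ℝ) ^ 2 = 0 :=
        (Finset.sum_eq_zero_iff_of_nonneg fun i _ => sq_nonneg ((k i : ℤ) : ℝ)).1 hsum0 j (Finset.mem_univ j)
      exact_mod_cast (pow_eq_zero_iff two_ne_zero).1 hj
    · exact h0
  have hX₀t : ∑ j, ((k j : ℤ) : ℂ) * X₀ j = 0 := hdiv₀.sum_mul_mFourierCoeff_eq_zero hw₀ k
  have hXt := h.ae_sum_mul_mFourierCoeff_eq_zero k
  have hall := ae_all_iff.2 fun i =>
    h.ae_sq_norm_inner_mFourierCoeff_eq hw₀i k (z := Z i) (FunctionSpaces.Torus.sum_mul_lerayFrameVec_eq_zero k i)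
  -- integrability of the summands on `(0,T)`
  have hI1 : ∀ i, IntegrableOn (fun τ => ‖⟪X τ, Z i⟫_ℂ‖ ^ 2) (Ioo 0 T) volume :=
    fun i => h.integrableOn_norm_sq_inner k (Z i)
  have hI2 : ∀ i, IntegrableOn (fun τ => (conj ⟪X τ, Z i⟫_ℂ *
      ((∑ j, (2 * Real.pi * I * (k j)) * ⟪F j τ, Z i⟫_ℂ) + (A : ℂ) * ∑ j, (2 * Real.pi * I * (k j)) * ⟪G j τ, Z i⟫_ℂ)).re)
      (Ioo 0 T) volume :=
    fun i => (h.integrableOn_conj_inner_mul k (Z i) (h.integrableOn_modeRHS_form k (Z i))).re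
  have hIi : ∀ i, IntegrableOn (fun τ => -(4 * Real.pi ^ 2 * ν * N) * ‖⟪X τ, Z i⟫_ℂ‖ ^ 2 +
      (conj ⟪X τ, Z i⟫_ℂ *
        ((∑ j, (2 * Real.pi * I * (k j)) * ⟪F j τ, Z i⟫_ℂ) + (A : ℂ) * ∑ j, (2 * Real.pi * I * (k j)) * ⟪G j τ, Z i⟫_ℂ)).re)
      (Ioo 0 T) volume :=
    fun i => ((hI1 i).const_mul _).add (hI2 i)
  -- the pointwise frame identities for a transversal `X τ`
  have hframe : ∀ᵐ τ ∂(volume.restrict (Ioo 0 T)),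
      ∑ i, (-(4 * Real.pi ^ 2 * ν * N) * ‖⟪X τ, Z i⟫_ℂ‖ ^ 2 +
        (conj ⟪X τ, Z i⟫_ℂ *
          ((∑ j, (2 * Real.pi * I * (k j)) * ⟪F j τ, Z i⟫_ℂ) + (A : ℂ) * ∑ j, (2 * Real.pi * I * (k j)) * ⟪G j τ, Z i⟫_ℂ)).re) =
      N ^ 2 * (-(4 * Real.pi ^ 2 * ν * N) * ‖X τ‖ ^ 2 +
        ((∑ j, (2 * Real.pi * I * (k j)) * ⟪F j τ, X τ⟫_ℂ) + (A : ℂ) * ∑ j, (2 * Real.pi * I * (k j)) * ⟪G j τ, X τ⟫_ℂ).re) := by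
    filter_upwards [hXt] with τ hτ
    rw [Finset.sum_add_distrib, ← Complex.re_sum, ← Finset.mul_sum,
      FunctionSpaces.Torus.sum_norm_sq_inner_lerayFrameVec k hτ,
      sum_conj_inner_mul_modeRHS k hτ A (fun j => F j τ) (fun j => G j τ), ← Complex.ofReal_pow,
      Complex.re_ofReal_mul]
    ring
  filter_upwards [hall, hXt, ae_restrict_mem measurableSet_Ioo] with t ht hXtt htT
  have hsub : Ioc 0 t ⊆ Ioo 0 T := Ioc_subset_Ioo_right htT.2
  -- sum the frame identities
  have hsum : ∑ i, ‖⟪X t, Z i⟫_ℂ‖ ^ 2 = ∑ i, (‖⟪X₀, Z i⟫_ℂ‖ ^ 2 +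
      2 * ∫ τ in Ioc 0 t, (-(4 * Real.pi ^ 2 * ν * N) * ‖⟪X τ, Z i⟫_ℂ‖ ^ 2 +
        (conj ⟪X τ, Z i⟫_ℂ *
          ((∑ j, (2 * Real.pi * I * (k j)) * ⟪F j τ, Z i⟫_ℂ) + (A : ℂ) * ∑ j, (2 * Real.pi * I * (k j)) * ⟪G j τ, Z i⟫_ℂ)).re)) :=
    Finset.sum_congr rfl fun i _ => ht i
  rw [FunctionSpaces.Torus.sum_norm_sq_inner_lerayFrameVec k hXtt, Finset.sum_add_distrib,
    FunctionSpaces.Torus.sum_norm_sq_inner_lerayFrameVec k hX₀t, ← Finset.mul_sum,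
    ← integral_finsetSum _ (fun i _ => (hIi i).mono_set hsub),
    integral_congr_ae (ae_restrict_of_ae_restrict_of_subset hsub hframe), integral_const_mul] at hsum
  -- cancel `N²`
  have hN2 : N ^ 2 ≠ 0 := by positivity
  have key : N ^ 2 * ‖X t‖ ^ 2 = N ^ 2 * (‖X₀‖ ^ 2 + 2 * ∫ τ in Ioc 0 t,
      (-(4 * Real.pi ^ 2 * ν * N) * ‖X τ‖ ^ 2 +
        ((∑ j, (2 * Real.pi * I * (k j)) * ⟪F j τ, X τ⟫_ℂ) + (A : ℂ) * ∑ j, (2 * Real.pi * I * (k j)) * ⟪G j τ, X τ⟫_ℂ).re)) := by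
    rw [hsum]
    ring
  exact mul_left_cancel₀ hN2 key

/-- **The modewise dissipation bound.** For `ν > 0`, a carrier bounded by `M` a.e. on `(0,T) × T^d`,
a datum `w₀ ∈ L²` weakly divergence free, every `k` and a.e. `t ∈ (0,T)`:
`‖ŵ(t)(k)‖² + 4π²ν|k|² ∫_{(0,t]} ‖ŵ(τ)(k)‖² dτ ≤ ‖ŵ₀(k)‖² + ((1 + A²)/ν) ∫_{(0,t]} γ_k(τ) dτ`,
`γ_k = ∑ⱼ (‖𝓕(bⱼw)(k)‖² + ‖𝓕(wⱼb)(k)‖²)` (the energy identity of the mode and Young's inequality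
`2 Re B(X) ≤ 4π²ν|k|²‖X‖² + (1+A²)γ_k/ν`; the uniform Galerkin bound of Robinson–Rodrigo–Sadowski
2016, (4.20), mode by mode). [cite: RobinsonRodrigoSadowski2016, §4.2 (4.20)] -/
theorem ae_sq_norm_add_dissipation_le (h : IsWeakPassiveVectorOn A T ν b w₀ w) (hν : 0 < ν)
    (hw₀ : MemLp w₀ 2 volume) (hdiv₀ : FunctionSpaces.Torus.IsWeaklyDivFree w₀) {M : ℝ} (hM : 0 ≤ M)
    (hbM : ∀ᵐ q ∂(((volume : Measure ℝ).restrict (Ioo 0 T)).prod (volume : Measure (UnitAddTorus d))),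
      ‖b q.1 q.2‖ ≤ M) (k : d → ℤ) :
    ∀ᵐ t ∂(volume.restrict (Ioo 0 T)),
      ‖mFourierCoeff (FunctionSpaces.EuclideanSpace.complexify ∘ w t) k‖ ^ 2 +
          4 * Real.pi ^ 2 * ν * FunctionSpaces.Torus.freqNormSq k *
            ∫ τ in Ioc 0 t, ‖mFourierCoeff (FunctionSpaces.EuclideanSpace.complexify ∘ w τ) k‖ ^ 2 ≤
        ‖mFourierCoeff (FunctionSpaces.EuclideanSpace.complexify ∘ w₀) k‖ ^ 2 +
          ((1 + A ^ 2) / ν) * ∫ τ in Ioc 0 t, ∑ j,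
            (‖mFourierCoeff (FunctionSpaces.EuclideanSpace.complexify ∘ fun x => b τ x j • w τ x) k‖ ^ 2 +
              ‖mFourierCoeff (FunctionSpaces.EuclideanSpace.complexify ∘ fun x => w τ x j • b τ x) k‖ ^ 2) := by
  set N : ℝ := FunctionSpaces.Torus.freqNormSq k with hN
  set X : ℝ → EuclideanSpace ℂ d := fun t => mFourierCoeff (FunctionSpaces.EuclideanSpace.complexify ∘ w t) k with hX
  set F : d → ℝ → EuclideanSpace ℂ d := fun j τ =>
    mFourierCoeff (FunctionSpaces.EuclideanSpace.complexify ∘ fun x => b τ x j • w τ x) k with hF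
  set G : d → ℝ → EuclideanSpace ℂ d := fun j τ =>
    mFourierCoeff (FunctionSpaces.EuclideanSpace.complexify ∘ fun x => w τ x j • b τ x) k with hG
  set γ : ℝ → ℝ := fun τ => ∑ j, (‖F j τ‖ ^ 2 + ‖G j τ‖ ^ 2) with hγ
  have hγi : IntegrableOn γ (Ioo 0 T) volume := h.integrableOn_fluxEnergy hM hbM k
  -- `‖X τ‖²` and `Re B_τ(X τ)` are integrable: a.e. equal to `N⁻²` times frame sums (for `k ≠ 0`),
  -- or directly bounded; we use the bound `‖X τ‖ ≤ K`
  obtain ⟨C₁, hC₁⟩ := h.exists_eLpNorm_le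
  have hXb : ∀ᵐ τ ∂(volume.restrict (Ioo 0 T)), ‖X τ‖ ≤ C₁ := by
    filter_upwards [hC₁, h.ae_memLp_two] with τ hτ hm
    have h1 : ‖X τ‖ ≤ ∫ x, ‖w τ x‖ := by
      rw [hX]
      simp only
      rw [FunctionSpaces.Torus.mFourierCoeff_eq_integral_volume]
      have hint : Integrable (fun x => mFourier (-k) x • (FunctionSpaces.EuclideanSpace.complexify ∘ w τ) x) volume :=
        FunctionSpaces.Torus.integrable_mFourier_smul'
          (FunctionSpaces.Torus.integrable_complexify_comp (hm.integrable one_le_two)) k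
      refine (norm_integral_le_integral_norm _).trans (integral_mono hint.norm (hm.integrable one_le_two).norm fun x => ?_)
      dsimp only
      rw [norm_smul, Function.comp_apply, FunctionSpaces.EuclideanSpace.norm_complexify]
      exact mul_le_of_le_one_left (norm_nonneg _) (((mFourier (-k)).norm_coe_le_norm x).trans_eq mFourier_norm)
    have h2 : ∫ x, ‖w τ x‖ ≤ C₁ := by
      have e1 : ENNReal.ofReal (∫ x, ‖w τ x‖) = eLpNorm (w τ) 1 volume := by
        rw [eLpNorm_one_eq_lintegral_enorm, ← ofReal_integral_norm_eq_lintegral_enorm (hm.integrable one_le_two)]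
      have e2 : ENNReal.ofReal (∫ x, ‖w τ x‖) ≤ C₁ :=
        e1.le.trans ((eLpNorm_le_eLpNorm_of_exponent_le (by norm_num) hm.1).trans hτ)
      have := (ENNReal.ofReal_le_iff_le_toReal ENNReal.coe_ne_top).1 e2
      simpa using this
    exact h1.trans h2
  have hXm : AEStronglyMeasurable X (volume.restrict (Ioo 0 T)) := (h.integrableOn_mFourierCoeff k).aestronglyMeasurable
  have hI3 : IntegrableOn (fun τ => ‖X τ‖ ^ 2) (Ioo 0 T) volume := by
    refine IntegrableOn.of_bound measure_Ioo_lt_top (hXm.norm.pow 2) (C₁ ^ 2) ?_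
    filter_upwards [hXb] with τ hτ
    rw [Real.norm_eq_abs, abs_of_nonneg (sq_nonneg _)]
    exact pow_le_pow_left₀ (norm_nonneg _) hτ 2
  -- `Re B_τ(X τ)` is integrable: `|⟪F_j, X⟫| ≤ ‖F_j‖ C₁`
  have hFi : ∀ j, IntegrableOn (F j) (Ioo 0 T) volume := fun j => h.integrableOn_mFourierCoeff_carrier_smul j k
  have hGi : ∀ j, IntegrableOn (G j) (Ioo 0 T) volume := fun j => h.integrableOn_mFourierCoeff_smul_carrier j k
  have hFX : ∀ j, IntegrableOn (fun τ => ⟪F j τ, X τ⟫_ℂ) (Ioo 0 T) volume := by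
    intro j
    refine Integrable.mono' ((hFi j).norm.mul_const C₁) ((hFi j).aestronglyMeasurable.inner hXm) ?_
    filter_upwards [hXb] with τ hτ
    exact (norm_inner_le_norm _ _).trans (mul_le_mul_of_nonneg_left hτ (norm_nonneg _))
  have hGX : ∀ j, IntegrableOn (fun τ => ⟪G j τ, X τ⟫_ℂ) (Ioo 0 T) volume := by
    intro j
    refine Integrable.mono' ((hGi j).norm.mul_const C₁) ((hGi j).aestronglyMeasurable.inner hXm) ?_
    filter_upwards [hXb] with τ hτ
    exact (norm_inner_le_norm _ _).trans (mul_le_mul_of_nonneg_left hτ (norm_nonneg _))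
  have hI4 : IntegrableOn (fun τ => ((∑ j, (2 * Real.pi * I * (k j)) * ⟪F j τ, X τ⟫_ℂ) +
      (A : ℂ) * ∑ j, (2 * Real.pi * I * (k j)) * ⟪G j τ, X τ⟫_ℂ).re) (Ioo 0 T) volume :=
    ((integrable_finsetSum _ fun j _ => (hFX j).const_mul _).add
      ((integrable_finsetSum _ fun j _ => (hGX j).const_mul _).const_mul _)).re
  set ν' : ℝ := 4 * Real.pi ^ 2 * ν * N with hν'
  set c : ℝ := (1 + A ^ 2) / ν with hc
  filter_upwards [h.ae_sq_norm_mFourierCoeff_eq hw₀ hdiv₀ k, ae_restrict_mem measurableSet_Ioo] with t ht htT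
  have hsub : Ioc 0 t ⊆ Ioo 0 T := Ioc_subset_Ioo_right htT.2
  have haT : IntegrableOn (fun τ => -ν' * ‖X τ‖ ^ 2) (Ioo 0 T) volume := hI3.const_mul (-ν')
  have hcT : IntegrableOn (fun τ => c * γ τ) (Ioo 0 T) volume := hγi.const_mul c
  have hfT : IntegrableOn (fun τ => -ν' * ‖X τ‖ ^ 2 +
      ((∑ j, (2 * Real.pi * I * (k j)) * ⟪F j τ, X τ⟫_ℂ) + (A : ℂ) * ∑ j, (2 * Real.pi * I * (k j)) * ⟪G j τ, X τ⟫_ℂ).re)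
      (Ioo 0 T) volume := haT.add hI4
  have hf := hfT.mono_set hsub
  have hgT : IntegrableOn (fun τ => -ν' * ‖X τ‖ ^ 2 + c * γ τ) (Ioo 0 T) volume := haT.add hcT
  have hg := hgT.mono_set hsub
  have hle : ∫ τ in Ioc 0 t, 2 * (-ν' * ‖X τ‖ ^ 2 +
      ((∑ j, (2 * Real.pi * I * (k j)) * ⟪F j τ, X τ⟫_ℂ) + (A : ℂ) * ∑ j, (2 * Real.pi * I * (k j)) * ⟪G j τ, X τ⟫_ℂ).re) ≤
      ∫ τ in Ioc 0 t, (-ν' * ‖X τ‖ ^ 2 + c * γ τ) := by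
    refine integral_mono (hf.const_mul 2) hg fun τ => ?_
    have hY := two_mul_re_modeRHS_le hν A k (X τ) (fun j => F j τ) (fun j => G j τ)
    dsimp only at hY ⊢
    rw [hγ, hc, hν']
    linarith
  have e1 : ∫ τ in Ioc 0 t, 2 * (-ν' * ‖X τ‖ ^ 2 +
      ((∑ j, (2 * Real.pi * I * (k j)) * ⟪F j τ, X τ⟫_ℂ) + (A : ℂ) * ∑ j, (2 * Real.pi * I * (k j)) * ⟪G j τ, X τ⟫_ℂ).re) =
      2 * ∫ τ in Ioc 0 t, (-ν' * ‖X τ‖ ^ 2 +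
      ((∑ j, (2 * Real.pi * I * (k j)) * ⟪F j τ, X τ⟫_ℂ) + (A : ℂ) * ∑ j, (2 * Real.pi * I * (k j)) * ⟪G j τ, X τ⟫_ℂ).re) :=
    integral_const_mul _ _
  have e2 : ∫ τ in Ioc 0 t, (-ν' * ‖X τ‖ ^ 2 + c * γ τ) =
      -ν' * (∫ τ in Ioc 0 t, ‖X τ‖ ^ 2) + c * ∫ τ in Ioc 0 t, γ τ := by
    rw [integral_add (haT.mono_set hsub) (hcT.mono_set hsub), integral_const_mul, integral_const_mul]
  rw [ht]
  linarith

end IsWeakPassiveVectorOn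

end ModeEnergy

end Torus

end Literature.Analysis.FluidPDE

end
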